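import Summits.AnomalousDissipation.AnomalousDissipation.Theses.TameDichotomy
import Literature.ModelTheory.ExponentialFields.OMinimalDefinability
import Literature.ModelTheory.ExponentialFields.OMinimalMonotonicityReal

/-!
# Birth skeleton (BC3) of the piece `TameViscousRealisation` (X₂ of the Euler-limit split of
`TameDichotomy.TameSteadyWitness`, crux-strategist stmt-AnomalousDissipation-2850, 2026-08-17)

The NO-CONCENTRATION line: realise the tame Euler dissipator by a tame steady Navier–Stokes family
converging in `L²` NORM; for an o-minimally definable family, norm convergence upgrades to a.e.
convergence along the full filter `ν → 0⁺` (monotonicity: every fibre `ν ↦ u_ν(x)` has a limit,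
which the `L²` limit identifies a.e.), and the energy bound is inherited from `ū ∈ L²` on a
smaller interval `(0, min δ δ₁)`.

* `stub_strongRealisation` (hardest, open — a TRANSFER stub: strong-`L²` realisation, no energy
  clause, no a.e. clause): for every tame dissipator `(L, f, ū)` an o-minimal `L'`, `δ > 0` and an
  `L'`-definable family of classical steady `NS_ν(f)` states with `∫ ‖u_ν − ū‖² → 0`.
* `stub_tameL2toAE` (true, M-sized, pure o-minimality + measure theory): for an o-minimally
  definable family of smooth fields, `L²`-convergence to `ū ∈ L²` implies a.e. convergence along
  `𝓝[>] 0`.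
* `TameViscousRealisation_of` (real proof): compose; energy bound `2 + 2 ∫ ‖ū‖²` once
  `∫ ‖u_ν − ū‖² < 1`, i.e. on some `(0, δ₁)`; restrict the definable graph to `(0, min δ δ₁)` by the
  definable half-space `v 0 < min δ δ₁`.
-/

set_option linter.dupNamespace false

noncomputable section

namespace Summit.AnomalousDissipation.AnomalousDissipation.Cruxes.TameSteadyWitness.BirthTameViscousRealisation

open scoped Topology InnerProductSpace
open Filter Set MeasureTheory
open Literature.Analysis.FunctionSpaces Literature.ModelTheory.ExponentialFields

/-- The piece `TameViscousRealisation` (X of this skeleton) — character-for-character the route child / the def in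
`Cruxes/TameSteadyWitness/Lines/euler_limit_split_assembly.lean` (namespace-local copy so that this
file does not depend on that module's build). -/
def TameViscousRealisation : Prop :=
  ∀ (L : FirstOrder.Language.{0, 0}) [L.Structure ℝ] (φ : FirstOrder.Language.LHom Literature.ModelTheory.ExponentialFields.Language.orderedRing L) [φ.IsExpansionOn ℝ], L.IsOMinimal ℝ → ∀ f : UnitAddTorus (Fin 3) → EuclideanSpace ℝ (Fin 3), Literature.Analysis.FunctionSpaces.Torus.IsSmooth f → Literature.Analysis.FunctionSpaces.Torus.IsDivFree f → Literature.Analysis.FunctionSpaces.Torus.HasZeroMean f → ∀ ū : UnitAddTorus (Fin 3) → EuclideanSpace ℝ (Fin 3), (Set.univ : Set ℝ).Definable L {v : Fin 6 → ℝ | v 0 ∈ Set.Ico (0 : ℝ) 1 ∧ v 1 ∈ Set.Ico (0 : ℝ) 1 ∧ v 2 ∈ Set.Ico (0 : ℝ) 1 ∧ v 3 = ū (Literature.Analysis.FunctionSpaces.Torus.proj !₂[v 0, v 1, v 2]) 0 ∧ v 4 = ū (Literature.Analysis.FunctionSpaces.Torus.proj !₂[v 0, v 1, v 2]) 1 ∧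 v 5 = ū (Literature.Analysis.FunctionSpaces.Torus.proj !₂[v 0, v 1, v 2]) 2} → MeasureTheory.MemLp ū 2 MeasureTheory.volume → Literature.Analysis.FunctionSpaces.Torus.IsWeaklyDivFree ū → (∀ w : UnitAddTorus (Fin 3) → EuclideanSpace ℝ (Fin 3), Literature.Analysis.FunctionSpaces.Torus.IsSmooth w → Literature.Analysis.FunctionSpaces.Torus.IsDivFree w → ∫ x, inner ℝ (ū x) (Literature.Analysis.FunctionSpaces.Torus.convect ū w x) + ∫ x, inner ℝ (f x) (w x) = 0) → 0 < ∫ x, inner ℝ (f x) (ū x) → ∃ (L' : FirstOrder.Language.{0, 0}) (_ : L'.Structure ℝ) (φ' : FirstOrder.Language.LHom Literature.ModelTheory.ExponentialFields.Language.orderedRing L') (_ : φ'.IsExpansionOn ℝ), L'.IsOMinimal ℝ ∧ ∃ (δ : ℝ) (u : ℝ → UnitAddTorus (Fin 3) → EuclideanSpace ℝ (Fin 3)) (p : ℝ → UnitAddTorus (Fin 3) → ℝ), 0 < δ ∧ (Set.univ : Set ℝ).Definable L' {v : Fin 7 → ℝ | v 0 ∈ Set.Ioo 0 δ ∧ v 1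 ∈ Set.Ico (0 : ℝ) 1 ∧ v 2 ∈ Set.Ico (0 : ℝ) 1 ∧ v 3 ∈ Set.Ico (0 : ℝ) 1 ∧ v 4 = u (v 0) (Literature.Analysis.FunctionSpaces.Torus.proj !₂[v 1, v 2, v 3]) 0 ∧ v 5 = u (v 0) (Literature.Analysis.FunctionSpaces.Torus.proj !₂[v 1, v 2, v 3]) 1 ∧ v 6 = u (v 0) (Literature.Analysis.FunctionSpaces.Torus.proj !₂[v 1, v 2, v 3]) 2} ∧ (∀ ν ∈ Set.Ioo 0 δ, Literature.Analysis.FunctionSpaces.Torus.IsClassicalNSSolutionOn Set.univ ν (fun _ => f) (fun _ => u ν) (fun _ => p ν)) ∧ (∃ E : ℝ, ∀ ν ∈ Set.Ioo 0 δ, ∫ x, ‖u ν x‖ ^ 2 ≤ E) ∧ ∀ᵐ x, Filter.Tendsto (fun ν => u ν x) (nhdsWithin 0 (Set.Ioi 0)) (nhds (ū x))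

/-- Signature of `stub_strongRealisation`: STRONG-`L²` TAME VISCOUS REALISATION of tame Euler
dissipators (hypotheses = the clauses of `TameEulerDissipator`; conclusion: an o-minimal `L'`, `δ > 0`
and an `L'`-definable family of classical steady `NS_ν(f)` states, `ν ∈ (0, δ)`, with
`∫ ‖u_ν − ū‖² → 0` as `ν → 0⁺`). -/
def Sig.stub_strongRealisation : Prop :=
  ∀ (L : FirstOrder.Language.{0, 0}) [L.Structure ℝ] (φ : FirstOrder.Language.LHom Literature.ModelTheory.ExponentialFields.Language.orderedRing L) [φ.IsExpansionOn ℝ], L.IsOMinimal ℝ → ∀ f : UnitAddTorus (Fin 3) → EuclideanSpace ℝ (Fin 3), Literature.Analysis.FunctionSpaces.Torus.IsSmooth f → Literature.Analysis.FunctionSpaces.Torus.IsDivFree f → Literature.Analysis.FunctionSpaces.Torus.HasZeroMean f → ∀ ū : UnitAddTorus (Fin 3) → EuclideanSpace ℝ (Fin 3), (Set.univ : Set ℝ).Definable L {v : Fin 6 → ℝ | v 0 ∈ Set.Ico (0 : ℝ) 1 ∧ v 1 ∈ Set.Ico (0 : ℝ) 1 ∧ v 2 ∈ Set.Ico (0 :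 ℝ) 1 ∧ v 3 = ū (Literature.Analysis.FunctionSpaces.Torus.proj !₂[v 0, v 1, v 2]) 0 ∧ v 4 = ū (Literature.Analysis.FunctionSpaces.Torus.proj !₂[v 0, v 1, v 2]) 1 ∧ v 5 = ū (Literature.Analysis.FunctionSpaces.Torus.proj !₂[v 0, v 1, v 2]) 2} → MeasureTheory.MemLp ū 2 MeasureTheory.volume → Literature.Analysis.FunctionSpaces.Torus.IsWeaklyDivFree ū → (∀ w : UnitAddTorus (Fin 3) → EuclideanSpace ℝ (Fin 3), Literature.Analysis.FunctionSpaces.Torus.IsSmooth w → Literature.Analysis.FunctionSpaces.Torus.IsDivFree w → ∫ x, inner ℝ (ū x) (Literature.Analysis.FunctionSpaces.Torus.convect ū w x) + ∫ x, inner ℝ (f x) (w x) = 0) → 0 < ∫ x, inner ℝ (f x) (ū x) → ∃ (L' : FirstOrder.Language.{0, 0}) (_ : L'.Structure ℝ) (φ' : FirstOrder.Language.LHom Literature.ModelTheory.ExponentialFields.Language.orderedRing L') (_ : φ'.IsExpansionOn ℝ), L'.IsOMinimal ℝ ∧ ∃ (δ : ℝ) (u : ℝ → UnitAddTorus (Fin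 3) → EuclideanSpace ℝ (Fin 3)) (p : ℝ → UnitAddTorus (Fin 3) → ℝ), 0 < δ ∧ (Set.univ : Set ℝ).Definable L' {v : Fin 7 → ℝ | v 0 ∈ Set.Ioo 0 δ ∧ v 1 ∈ Set.Ico (0 : ℝ) 1 ∧ v 2 ∈ Set.Ico (0 : ℝ) 1 ∧ v 3 ∈ Set.Ico (0 : ℝ) 1 ∧ v 4 = u (v 0) (Literature.Analysis.FunctionSpaces.Torus.proj !₂[v 1, v 2, v 3]) 0 ∧ v 5 = u (v 0) (Literature.Analysis.FunctionSpaces.Torus.proj !₂[v 1, v 2, v 3]) 1 ∧ v 6 = u (v 0) (Literature.Analysis.FunctionSpaces.Torus.proj !₂[v 1, v 2, v 3]) 2} ∧ (∀ ν ∈ Set.Ioo 0 δ, Literature.Analysis.FunctionSpaces.Torus.IsClassicalNSSolutionOn Set.univ ν (fun _ => f) (fun _ => u ν) (fun _ => p ν)) ∧ Filter.Tendsto (fun ν => ∫ x, ‖u ν x - ū x‖ ^ 2) (nhdsWithin 0 (Set.Ioi 0)) (nhds 0)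

/-- Signature of `stub_tameL2toAE`: for an o-minimally definable family of smooth fields on
`(0, δ)`, `L²`-norm convergence to `ū ∈ L²` as `ν → 0⁺` implies a.e. convergence along the full
filter `𝓝[>] 0` (monotonicity theorem fibrewise + a.e. identification of the limit). -/
def Sig.stub_tameL2toAE : Prop :=
  ∀ (L' : FirstOrder.Language.{0, 0}) [L'.Structure ℝ] (φ' : FirstOrder.Language.LHom Literature.ModelTheory.ExponentialFields.Language.orderedRing L') [φ'.IsExpansionOn ℝ], L'.IsOMinimal ℝ → ∀ (δ : ℝ) (u : ℝ → UnitAddTorus (Fin 3) → EuclideanSpace ℝ (Fin 3)) (ū : UnitAddTorus (Fin 3) → EuclideanSpace ℝ (Fin 3)), 0 < δ → (Set.univ : Set ℝ).Definable L' {v : Fin 7 → ℝ | v 0 ∈ Set.Ioo 0 δ ∧ v 1 ∈ Set.Ico (0 : ℝ) 1 ∧ v 2 ∈ Set.Ico (0 : ℝ) 1 ∧ v 3 ∈ Set.Ico (0 : ℝ) 1 ∧ v 4 = u (v 0) (Literature.Analysis.FunctionSpaces.Torus.proj !₂[v 1, v 2, v 3]) 0 ∧ v 5 = u (v 0) (Literature.Analysis.FunctionSpaces.Torus.proj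 !₂[v 1, v 2, v 3]) 1 ∧ v 6 = u (v 0) (Literature.Analysis.FunctionSpaces.Torus.proj !₂[v 1, v 2, v 3]) 2} → (∀ ν ∈ Set.Ioo 0 δ, Literature.Analysis.FunctionSpaces.Torus.IsSmooth (u ν)) → MeasureTheory.MemLp ū 2 MeasureTheory.volume → Filter.Tendsto (fun ν => ∫ x, ‖u ν x - ū x‖ ^ 2) (nhdsWithin 0 (Set.Ioi 0)) (nhds 0) → ∀ᵐ x, Filter.Tendsto (fun ν => u ν x) (nhdsWithin 0 (Set.Ioi 0)) (nhds (ū x))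

/-- STUB (hardest, open): strong-`L²` tame viscous realisation. -/
theorem stub_strongRealisation : Sig.stub_strongRealisation := by
  sorry

/-- STUB (true, M): tame `L²`-to-a.e. upgrade. -/
theorem stub_tameL2toAE : Sig.stub_tameL2toAE := by
  sorry

/-- A smooth field on the (compact, probability) torus is in `L²`. -/
theorem memLp_two_of_isSmooth {v : UnitAddTorus (Fin 3) → EuclideanSpace ℝ (Fin 3)}
    (hv : Torus.IsSmooth v) : MemLp v 2 volume := by
  have hc : Continuous v := hv.continuous
  obtain ⟨C, hC⟩ := (isCompact_univ (X := UnitAddTorus (Fin 3))).exists_bound_of_continuousOn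
    hc.continuousOn
  have htop : MemLp v ⊤ volume :=
    memLp_top_of_bound hc.aestronglyMeasurable C (Eventually.of_forall fun x => hC x (mem_univ x))
  exact htop.mono_exponent le_top

/-- COMPOSITION (real proof). -/
theorem TameViscousRealisation_of (h₁ : Sig.stub_strongRealisation) (h₂ : Sig.stub_tameL2toAE) :
    TameViscousRealisation := by
  intro L instL φ instφ hO f hf hdiv hmean ū hdef hL2 hwdiv hEuler hpos
  obtain ⟨L', instL', φ', instφ', hO', δ, u, p, hδ, hdefu, hsol, hconv⟩ :=
    @h₁ L instL φ instφ hO f hf hdiv hmean ū hdef hL2 hwdiv hEuler hpos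
  have hsm : ∀ ν ∈ Set.Ioo 0 δ, Torus.IsSmooth (u ν) := fun ν hν =>
    (hsol ν hν).smooth_velocity.isSmooth_slice (Set.mem_univ (0 : ℝ))
  -- a.e. convergence along the full filter (tame upgrade)
  have hae : ∀ᵐ x, Tendsto (fun ν => u ν x) (𝓝[>] 0) (𝓝 (ū x)) :=
    @h₂ L' instL' φ' instφ' hO' δ u ū hδ hdefu hsm hL2 hconv
  -- eventually the `L²` distance is `< 1`
  have hev : ∀ᶠ ν in 𝓝[>] (0 : ℝ), ∫ x, ‖u ν x - ū x‖ ^ 2 < 1 := hconv.eventually_lt_const one_pos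
  obtain ⟨δ₁, hδ₁, hsub⟩ := mem_nhdsGT_iff_exists_Ioo_subset.1 hev
  have hδ₁' : (0 : ℝ) < δ₁ := hδ₁
  -- integrability facts
  have hint_ū : Integrable (fun x => ‖ū x‖ ^ 2) volume :=
    (memLp_two_iff_integrable_sq_norm hL2.1).1 hL2
  refine ⟨L', instL', φ', instφ', hO', min δ δ₁, u, p, lt_min hδ hδ₁', ?_, ?_, ?_, hae⟩
  · -- definable restriction of the graph
    have hlt := definable_lt_of_expansion (M := ℝ) φ'
    have hhalf : (Set.univ : Set ℝ).Definable L' {v : Fin 7 → ℝ | v 0 < min δ δ₁} :=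
      definable_setOf_lt hlt (definableFun_proj 0) (definableFun_const' _ _)
    convert hdefu.inter hhalf using 1
    ext v
    simp only [Set.mem_setOf_eq, Set.mem_inter_iff, Set.mem_Ioo, lt_min_iff]
    constructor
    · rintro ⟨⟨h0, hδa, hδb⟩, hrest⟩
      exact ⟨⟨⟨h0, hδa⟩, hrest⟩, hδa, hδb⟩
    · rintro ⟨⟨⟨h0, hδa⟩, hrest⟩, -, hδb⟩
      exact ⟨⟨h0, hδa, hδb⟩, hrest⟩
  · intro ν hν
    exact hsol ν ⟨hν.1, hν.2.trans_le (min_le_left _ _)⟩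
  · -- energy bound `2 + 2 ∫ ‖ū‖²` on `(0, min δ δ₁)`
    refine ⟨2 * 1 + 2 * (∫ x, ‖ū x‖ ^ 2), fun ν hν => ?_⟩
    have hν' : ν ∈ Set.Ioo 0 δ := ⟨hν.1, hν.2.trans_le (min_le_left _ _)⟩
    have h1 : ∫ x, ‖u ν x - ū x‖ ^ 2 < 1 := hsub ⟨hν.1, hν.2.trans_le (min_le_right _ _)⟩
    have hmu : MemLp (u ν) 2 volume := memLp_two_of_isSmooth (hsm ν hν')
    have hint_u : Integrable (fun x => ‖u ν x‖ ^ 2) volume :=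
      (memLp_two_iff_integrable_sq_norm hmu.1).1 hmu
    have hmd : MemLp (fun x => u ν x - ū x) 2 volume := hmu.sub hL2
    have hint_d : Integrable (fun x => ‖u ν x - ū x‖ ^ 2) volume :=
      (memLp_two_iff_integrable_sq_norm hmd.1).1 hmd
    have hpt : ∀ x, ‖u ν x‖ ^ 2 ≤ 2 * ‖u ν x - ū x‖ ^ 2 + 2 * ‖ū x‖ ^ 2 := fun x => by
      have h := norm_add_le (u ν x - ū x) (ū x)
      rw [sub_add_cancel] at h
      have h2 : ‖u ν x‖ * ‖u ν x‖ ≤ (‖u ν x - ū x‖ + ‖ū x‖) * (‖u ν x - ū x‖ + ‖ū x‖) :=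
        mul_self_le_mul_self (norm_nonneg _) h
      nlinarith [h2, sq_nonneg (‖u ν x - ū x‖ - ‖ū x‖)]
    calc ∫ x, ‖u ν x‖ ^ 2 ≤ ∫ x, (2 * ‖u ν x - ū x‖ ^ 2 + 2 * ‖ū x‖ ^ 2) :=
          integral_mono hint_u ((hint_d.const_mul 2).add (hint_ū.const_mul 2)) hpt
      _ = 2 * (∫ x, ‖u ν x - ū x‖ ^ 2) + 2 * (∫ x, ‖ū x‖ ^ 2) := by
          rw [integral_add (hint_d.const_mul 2) (hint_ū.const_mul 2), integral_const_mul,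
            integral_const_mul]
      _ ≤ 2 * 1 + 2 * (∫ x, ‖ū x‖ ^ 2) := by nlinarith [h1.le]

/-- The piece, modulo the two registered stubs. -/
theorem TameViscousRealisation_candidate : TameViscousRealisation :=
  TameViscousRealisation_of stub_strongRealisation stub_tameL2toAE

end Summit.AnomalousDissipation.AnomalousDissipation.Cruxes.TameSteadyWitness.BirthTameViscousRealisation

end
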